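import Mathlib
import HarnessLib

/-!
# Route `FilamentSkeletonRss` — vocabulary posited by the K1′ RE-SEAM (coordinator ruling 2026-08-17,
# `Cruxes/SelectionBox/STRATEGY-CENSUS.md` §7 VARIANT (A)): the EXCHANGE CERTIFICATE of a skeleton box

The re-seamed cruxes `CertifiedSelectionBox` (K1‴: the tilted, parameter-bounded ball box, conjuncts
1–2 of `SelectionBoxR`, PLUS this certificate) and `SignedTransverseReduction` (K2s: the transverse
reduction whose OWN output family obeys the accretion sign law GIVEN this certificate) talk to each other
through ONE named predicate, `FilamentExchange.ExchangeCertificate`, typed here once so that both route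
items reference it by name.

CONTENT = the exponent-level ACTION-GAP certificate of strategist s1's registered line
`Cruxes/SelectionBoxR/Lines/action_gap_seam.lean` (`GapCert`, 2026-08-17; definitions copied VERBATIM,
only re-homed into an importable module — crux workfiles under `Cruxes/` are not importable from `Theses/`
or `Theorems/`).  In the rescaled variables `ξ = y/√Γ` (filaments `X̃ = Γ^(-1/2) X(√Γ·)`, frame field
`W̃_p = Γ^(-1/2) v_p(√Γ·)`, an `O(1)` field; small diffusivity `1/Γ`, so steady transported densities are
`≍ e^(−Γ·(Freidlin–Wentzell action))`), with tubes of radius `ρ/4` about the filaments excised from the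
window ball `‖ξ‖ ≤ R_w` ("visible region"), the certificate compares, for every box parameter `p` and
filament `j`, the EXPORT exponent `e_j` (cheapest capture-leaving excursion from tube `j`'s wall, weighted
at re-absorption by the axial potential `P_j = ∫ w̃_j` — the weight `e^(−ΓP)` of the 1-D accretion budget
identity `B ∫e^(−W)μ = −∫e^(−W)F`) with the IMPORT exponents `i_j` (unsigned, generous: every other wall and
the window edge are free sources) and `i_j^±` (from the other walls, arrival co- or counter-oriented after
transport of the donor's signed tangent along the path):
on the face `p_j = 1` filament `j` is export-dominated (`e_j + g₀ ≤ i_j`, `e_j < ∞`), on the face `p_j = 0`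
it is import-dominated by co-oriented donors (`i_j⁺ + g₀ ≤ min(e_j, i_j⁻)`, `i_j⁺ < ∞`).  Since the net
steady circulation budget of tube `j` reads `B_pj · mass(D_pj) ∝ (export) + (counter-import) − (co-import)`
at exponent level, a margin `g₀` exceeding the in-tube slack (`Λρ² ≤ g₀` is demanded by the items) flips the
sign of `B_pj` between the two faces — which is what `SignedTransverseReduction` must prove FOR ITS OWN
(Burgers-dressed, exponentially wall-confined) family, and what `CertifiedSelectionBox` must certify on the
skeleton (finite-dimensional: quasipotentials of an explicit `O(1)` field; gMAM / ordered-upwind numerics,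
interval upper bounds by explicit paths, lower bounds by HJ sub-solutions).

Design: plain `def`s over Mathlib only (`Metric.infDist`, `sInf` in `ℝ≥0∞`, `intervalIntegral`, `deriv`,
`fderiv`, `ContDiff`); junk-free (`sInf ∅ = ⊤` is the intended value "no admissible path / no wall point",
and the items guard the finiteness they need with `≠ ⊤`).  Nothing here restates a tree notion
(`lean search` 2026-08-18: `qPot` / `fwAction` / `exportExp` / `importExp` are declared only in the crux
workfile above, namespace `…Cruxes.SelectionBoxR.ActionGapSeam`).  What is NOT here: the box clauses, the
admissibility clauses and the sign law (they stay inlined VERBATIM in the route items, as in rev 9), and any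
claim — this file has no theorems.

## References

* M. I. Freidlin, A. D. Wentzell, *Random Perturbations of Dynamical Systems*, 3rd ed., Springer 2012,
  Ch. 4 (action functional), Ch. 6 §6.1 (quasipotential). [FreidlinWentzell2012]
* strategist s1, `Cruxes/SelectionBoxR/Lines/action_gap_seam.lean` (line `action_gap_seam`, stmt-19174);
  ideator k3, `Cruxes/SelectionBox/Ideas/thin-tube-action-sandwich.md`; strategist b1, line
  `ball_box_sign_transfer` (stmt-18687: `ExchangeCertificate`, `SignedTransverseReduction`).
-/

set_option linter.dupNamespace false -- the module path `Summits.NavierStokesRegularity.NavierStokesRegularity.…` repeats a component by layout (D-0017)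

noncomputable section

namespace Summit.NavierStokesRegularity.NavierStokesRegularity.Theorems.FilamentExchange

open scoped Topology ENNReal InnerProductSpace
open Set Function MeasureTheory

/-- Rescaled filament `X̃(s) = Γ^(-1/2) X(√Γ s)` (unit speed is preserved). [folklore] -/
def rsCurve (Γ : ℝ) (Y : ℝ → EuclideanSpace ℝ (Fin 3)) : ℝ → EuclideanSpace ℝ (Fin 3) :=
  fun s => (Real.sqrt Γ)⁻¹ • Y (Real.sqrt Γ * s)

/-- Rescaled frame field `W̃(ξ) = Γ^(-1/2) v(√Γ ξ)` (an `O(1)` field: Biot–Savart of the rescaled filaments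
with circulations `γ_k`, plus `½ξ − α e₃×ξ`, up to `O(Γ^(-1/2))` core regularisation). [folklore] -/
def rsField (Γ : ℝ) (V : EuclideanSpace ℝ (Fin 3) → EuclideanSpace ℝ (Fin 3)) :
    EuclideanSpace ℝ (Fin 3) → EuclideanSpace ℝ (Fin 3) :=
  fun ξ => (Real.sqrt Γ)⁻¹ • V (Real.sqrt Γ • ξ)

/-- Axial potential of a filament in ξ-units: `P(s) = Γ⁻¹ ∫_c^(√Γ s) w = ∫_(c/√Γ)^s w̃`,
`w̃(σ) = Γ^(-1/2) w(√Γ σ)`; nonnegative for a slip `w` with a unique increasing zero at `c`;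
`e^(−Γ P)` is the weight of the 1-D accretion budget. [folklore] -/
def axialPot (Γ : ℝ) (ws : ℝ → ℝ) (c₀ : ℝ) (s : ℝ) : ℝ :=
  Γ⁻¹ * ∫ τ in c₀..(Real.sqrt Γ * s), ws τ

/-- Freidlin–Wentzell action of a path for the drift `W` (diffusivity `1/Γ` in ξ-units ⇒ densities
`≍ e^(−Γ·action)`). [cite: FreidlinWentzell2012, Ch. 4 §1] -/
def fwAction (W : EuclideanSpace ℝ (Fin 3) → EuclideanSpace ℝ (Fin 3)) (T : ℝ)
    (φ : ℝ → EuclideanSpace ℝ (Fin 3)) : ℝ :=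
  ∫ t in (0:ℝ)..T, ‖deriv φ t - W (φ t)‖ ^ 2 / 4

/-- Point-to-point quasipotential of `W` with `C¹` paths confined to `S` (value `∞` if none).
[cite: FreidlinWentzell2012, Ch. 6 §1] -/
def qPot (W : EuclideanSpace ℝ (Fin 3) → EuclideanSpace ℝ (Fin 3)) (S : Set (EuclideanSpace ℝ (Fin 3)))
    (x y : EuclideanSpace ℝ (Fin 3)) : ℝ≥0∞ :=
  sInf {r : ℝ≥0∞ | ∃ (T : ℝ) (φ : ℝ → EuclideanSpace ℝ (Fin 3)), 0 ≤ T ∧ ContDiff ℝ 1 φ ∧ φ 0 = x ∧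
    φ T = y ∧ (∀ t ∈ Icc 0 T, φ t ∈ S) ∧ r = ENNReal.ofReal (fwAction W T φ)}

/-- Open tube of radius `r` about a curve. [folklore] -/
def tube (Y : ℝ → EuclideanSpace ℝ (Fin 3)) (r : ℝ) : Set (EuclideanSpace ℝ (Fin 3)) :=
  {ξ | Metric.infDist ξ (range Y) < r}

/-- Visible region: the closed window ball minus the open tubes. [folklore] -/
def visible {N : ℕ} (Y : Fin N → ℝ → EuclideanSpace ℝ (Fin 3)) (r R : ℝ) :
    Set (EuclideanSpace ℝ (Fin 3)) :=
  Metric.closedBall (0 : EuclideanSpace ℝ (Fin 3)) R \ ⋃ k, tube (Y k) r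

/-- Wall of filament `k`: visible points at distance exactly `r` from it. [folklore] -/
def wall {N : ℕ} (Y : Fin N → ℝ → EuclideanSpace ℝ (Fin 3)) (r R : ℝ) (k : Fin N) :
    Set (EuclideanSpace ℝ (Fin 3)) :=
  {ξ | ξ ∈ visible Y r R ∧ Metric.infDist ξ (range (Y k)) = r}

/-- Foot cost of a wall point: the least axial potential among its feet within `2r` (value `∞` if none).
[folklore] -/
def footCost (P : ℝ → ℝ) (Yk : ℝ → EuclideanSpace ℝ (Fin 3)) (r : ℝ) (ζ : EuclideanSpace ℝ (Fin 3)) :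
    ℝ≥0∞ :=
  sInf {q : ℝ≥0∞ | ∃ s : ℝ, ‖ζ - Yk s‖ ≤ 2 * r ∧ q = ENNReal.ofReal (P s)}

/-- Weight exponent `Θ_j(b) = inf_ζ [V(b → ζ) + P_j(ζ)]` over wall points `ζ` of `j`: the large-deviation
exponent of the adjoint (committor) zero mode that defines `B_pj` — reach tube `j`, then climb to its waist.
[folklore] -/
def weightExp {N : ℕ} (W : EuclideanSpace ℝ (Fin 3) → EuclideanSpace ℝ (Fin 3))
    (Y : Fin N → ℝ → EuclideanSpace ℝ (Fin 3)) (P : Fin N → ℝ → ℝ) (r R : ℝ) (j : Fin N)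
    (b : EuclideanSpace ℝ (Fin 3)) : ℝ≥0∞ :=
  sInf {q : ℝ≥0∞ | ∃ ζ : EuclideanSpace ℝ (Fin 3), ζ ∈ wall Y r R j ∧
    q = qPot W (visible Y r R) b ζ + footCost (P j) (Y j) r ζ}

/-- Captured set of filament `j`: visible points that reach its wall at zero cost (forward streamlines).
[folklore] -/
def captured {N : ℕ} (W : EuclideanSpace ℝ (Fin 3) → EuclideanSpace ℝ (Fin 3))
    (Y : Fin N → ℝ → EuclideanSpace ℝ (Fin 3)) (r R : ℝ) (j : Fin N) : Set (EuclideanSpace ℝ (Fin 3)) :=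
  {b | b ∈ visible Y r R ∧ sInf {q : ℝ≥0∞ | ∃ ζ : EuclideanSpace ℝ (Fin 3), ζ ∈ wall Y r R j ∧
    q = qPot W (visible Y r R) b ζ} = 0}

/-- EXPORT exponent of filament `j`: cheapest capture-leaving excursion from its wall, weighted at
re-absorption: `e_j = inf {V(ξ → b) + Θ_j(b) : ξ ∈ wall_j, b visible and not captured by j}`. [folklore] -/
def exportExp {N : ℕ} (W : EuclideanSpace ℝ (Fin 3) → EuclideanSpace ℝ (Fin 3))
    (Y : Fin N → ℝ → EuclideanSpace ℝ (Fin 3)) (P : Fin N → ℝ → ℝ) (r R : ℝ) (j : Fin N) : ℝ≥0∞ :=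
  sInf {q : ℝ≥0∞ | ∃ ξ b : EuclideanSpace ℝ (Fin 3), ξ ∈ wall Y r R j ∧ b ∈ visible Y r R ∧
    b ∉ captured W Y r R j ∧ q = qPot W (visible Y r R) ξ b + weightExp W Y P r R j b}

/-- Unsigned IMPORT exponent into filament `j` (generous: every other wall and the window edge are free
sources): `i_j = inf {V(x → ζ) + P_j(ζ) : x ∈ sphere(0,R) ∪ ⋃_(k≠j) wall_k, ζ ∈ wall_j}`. [folklore] -/
def importExp {N : ℕ} (W : EuclideanSpace ℝ (Fin 3) → EuclideanSpace ℝ (Fin 3))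
    (Y : Fin N → ℝ → EuclideanSpace ℝ (Fin 3)) (P : Fin N → ℝ → ℝ) (r R : ℝ) (j : Fin N) : ℝ≥0∞ :=
  sInf {q : ℝ≥0∞ | ∃ x ζ : EuclideanSpace ℝ (Fin 3),
    (x ∈ Metric.sphere (0 : EuclideanSpace ℝ (Fin 3)) R ∨ ∃ k, k ≠ j ∧ x ∈ wall Y r R k) ∧
    ζ ∈ wall Y r R j ∧ q = qPot W (visible Y r R) x ζ + footCost (P j) (Y j) r ζ}

/-- ORIENTED import exponent into filament `j` from the other walls (`ε = 1`: arrivals co-oriented with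
`sgn γ_j · t_j`, `ε = −1`: counter-oriented), the donor direction `sgn γ_k · t_k` being transported along the
path by the linearised field (material line elements, `ℓ′ = DW(φ) ℓ`): co-oriented arrivals add
circulation, counter-oriented ones cancel it. [folklore] -/
def importExpOr {N : ℕ} (W : EuclideanSpace ℝ (Fin 3) → EuclideanSpace ℝ (Fin 3))
    (Y : Fin N → ℝ → EuclideanSpace ℝ (Fin 3)) (sg : Fin N → ℝ) (P : Fin N → ℝ → ℝ) (r R : ℝ)
    (j : Fin N) (ε : ℝ) : ℝ≥0∞ :=
  sInf {q : ℝ≥0∞ | ∃ (k : Fin N) (σ s T : ℝ) (φ ℓ : ℝ → EuclideanSpace ℝ (Fin 3)), k ≠ j ∧ 0 ≤ T ∧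
    ContDiff ℝ 1 φ ∧ φ 0 ∈ wall Y r R k ∧ ‖φ 0 - Y k σ‖ ≤ 2 * r ∧ φ T ∈ wall Y r R j ∧
    ‖φ T - Y j s‖ ≤ 2 * r ∧ (∀ t ∈ Icc 0 T, φ t ∈ visible Y r R) ∧ ℓ 0 = sg k • deriv (Y k) σ ∧
    (∀ t, HasDerivAt ℓ (fderiv ℝ W (φ t) (ℓ t)) t) ∧ 0 < ε * sg j * ⟪ℓ T, deriv (Y j) s⟫_ℝ ∧
    q = ENNReal.ofReal (fwAction W T φ) + ENNReal.ofReal (P j s)}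

/-- **The exchange certificate** (= the action-gap certificate `GapCert` of line `action_gap_seam`) of an
`N`-parameter skeleton box at circulation `Γ`, with wall radius `ρ/4`, window `Rw` (ξ-units) and margin
`g₀`: for every box parameter `p ∈ [0,1]^N` and filament `j`, computed on the rescaled data
(`W̃_p = rsField Γ (v p)`, `X̃_p = rsCurve Γ ∘ X p`, `P_k = axialPot Γ (w p k) (c p k)`):
on the face `p_j = 1` filament `j` is EXPORT-dominated (`e_j + g₀ ≤ i_j`, `e_j < ∞`), on the face `p_j = 0`
it is IMPORT-dominated by co-oriented donors (`i_j⁺ + g₀ ≤ min(e_j, i_j⁻)`, `i_j⁺ < ∞`).  This is the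
finite-dimensional datum the box constructor certifies and the transverse reduction converts into the sign
of its own accretion scalars. [folklore] -/
def ExchangeCertificate (N : ℕ) (Γ ρ Rw g₀ : ℝ) (γ : (Fin N → ℝ) → Fin N → ℝ)
    (X : (Fin N → ℝ) → Fin N → ℝ → EuclideanSpace ℝ (Fin 3)) (w : (Fin N → ℝ) → Fin N → ℝ → ℝ)
    (c : (Fin N → ℝ) → Fin N → ℝ) (v : (Fin N → ℝ) → EuclideanSpace ℝ (Fin 3) → EuclideanSpace ℝ (Fin 3)) :
    Prop :=
  ∀ p : Fin N → ℝ, (∀ i, p i ∈ Icc (0:ℝ) 1) → ∀ j : Fin N,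
    (p j = 1 →
      exportExp (rsField Γ (v p)) (fun k => rsCurve Γ (X p k)) (fun k => axialPot Γ (w p k) (c p k))
          (ρ/4) Rw j + ENNReal.ofReal g₀
        ≤ importExp (rsField Γ (v p)) (fun k => rsCurve Γ (X p k)) (fun k => axialPot Γ (w p k) (c p k))
          (ρ/4) Rw j ∧
      exportExp (rsField Γ (v p)) (fun k => rsCurve Γ (X p k)) (fun k => axialPot Γ (w p k) (c p k))
          (ρ/4) Rw j ≠ ⊤) ∧
    (p j = 0 →
      importExpOr (rsField Γ (v p)) (fun k => rsCurve Γ (X p k)) (fun k => Real.sign (γ p k))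
          (fun k => axialPot Γ (w p k) (c p k)) (ρ/4) Rw j 1 + ENNReal.ofReal g₀
        ≤ min (exportExp (rsField Γ (v p)) (fun k => rsCurve Γ (X p k))
              (fun k => axialPot Γ (w p k) (c p k)) (ρ/4) Rw j)
            (importExpOr (rsField Γ (v p)) (fun k => rsCurve Γ (X p k)) (fun k => Real.sign (γ p k))
              (fun k => axialPot Γ (w p k) (c p k)) (ρ/4) Rw j (-1)) ∧
      importExpOr (rsField Γ (v p)) (fun k => rsCurve Γ (X p k)) (fun k => Real.sign (γ p k))
          (fun k => axialPot Γ (w p k) (c p k)) (ρ/4) Rw j 1 ≠ ⊤)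

end Summit.NavierStokesRegularity.NavierStokesRegularity.Theorems.FilamentExchange

end
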